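import Literature.NumberTheory.EllipticCurves.AnticyclotomicSignedCompactSelmerTorsionFreeProofs
import Literature.NumberTheory.EllipticCurves.AnticyclotomicSignedTransferInputs
import Summits.BirchSwinnertonDyer.BirchSwinnertonDyer.Theorems.UniversalToricDescentSignedSettingLayerControl
import HarnessLib

/-!
# The field `torsionFree` of Castella–Wan's `TransferInputs` is a THEOREM in the `AcSigned.Setting`
# (crux `AnticyclotomicEisensteinDivisibility`, stmt-BirchSwinnertonDyer-20727, line `bdpline`; helper)

Lead prover seat `bsd-line-sbc-p1` (gen 9), route `SignedBaseChange` of the BSD summit, `--supports`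
stmt-BirchSwinnertonDyer-20727. The registered skeleton `Lines/bdpline.lean` (v33) closes the crux modulo its
stubs; conjunct 3 of `stub_namedFactsSS` is the refereed named fact
`AcSigned.castellaWan2024_proofThm68_transferInputs` (Castella–Wan 2024, the inputs of the proof of Thm. 6.8,
MS pp. 29–31), which asserts, for every sign, the EXISTENCE of the six-field hypothesis structure
`AcSigned.TransferInputs` (file `Literature/…/AnticyclotomicSignedTransferInputs.lean`). Its FIRST field is

  `torsionFree : ∀ (𝓛 : HeightOneSpectrum (𝓞 K) → PCond) (f : IwasawaAlgebra p)
     (x : selmerLambdaAdic W p κ γ 𝓛), (letI := selmerLambdaAdic.moduleOfGen W p κ γ hγ 𝓛; f • x) = 0 → f = 0 ∨ x = 0`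

("[PR00, §1.3.3]: `H¹(K, 𝐓^ac)`, hence every `Sel^{𝓛}(K, 𝐓^ac)`, has no `Λ^ac`-torsion", MS p. 30). This file
records that this field is a KERNEL THEOREM for the consumers' curve `W⁄K` in the `AcSigned.Setting`:
`transferInputs_torsionFree_of_setting` — from the Literature proofs file
`AnticyclotomicSignedCompactSelmerTorsionFreeProofs` (`selmerLambdaAdic.forall_smul_eq_zero_imp`, the
levelwise/Shapiro-free torsion-freeness of the signed compact carriers under `E(K)[p] = 0`) and the tree theorem
`UniversalToricDescentSignedSetting.noPTorsion_base_of_setting` (`E(K)[p] = 0` in the `Setting`: `a_p = 0`,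
`p` split, so `E(K_𝔭)[p] = E(ℚ_p)[p] = 0`). HONEST FRAMING: the named fact is NOT discharged (its other five
fields — the global-duality sequences (6.12)–(6.13), Lemma 6.7 (2), the explicit reciprocity law Thm. 6.2 as
`signedLog_erl`, Cor. 6.4 as `loc_nonTorsion` — remain literature inputs) and its text is unchanged; what changes
is the trust base of the line: one of the six bundled inputs is proved. Nothing of the crux's research stubs is
proved; BSD is not proved by any of this; no summit statement is proved by this seat.

References: [CastellaWan2023] F. Castella, X. Wan, Math. Ann. 389 (2024), proof of Thm. 6.8 (MS p. 30);
[PerrinRiou1995Asterisque] B. Perrin-Riou, Astérisque 229 (1995), §1.3.3; [IovitaPollack2006] Lemma 2.1.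
-/

set_option autoImplicit false
-- `…BirchSwinnertonDyer.BirchSwinnertonDyer.Theorems…` is the problem's mandated namespace (D-0017).
set_option linter.dupNamespace false

noncomputable section

open scoped Classical

namespace Summit.BirchSwinnertonDyer.BirchSwinnertonDyer.Theorems.SignedBaseChangeAcDivTransferTorsionFree

open NumberField IsDedekindDomain Field WeierstrassCurve
open Literature.NumberTheory.EllipticCurves Literature.NumberTheory.EllipticCurves.AcSigned
  Summit.BirchSwinnertonDyer.BirchSwinnertonDyer.Theorems.UniversalToricDescentSignedSetting

variable (W : WeierstrassCurve ℚ) [W.IsGloballyMinimal] (K : Type) [Field K] [NumberField K]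
  (p : ℕ) [Fact p.Prime] (κ : ZpExtension K p) (𝔭 𝔭' : HeightOneSpectrum (𝓞 K))

/-- **The field `TransferInputs.torsionFree` holds in the `AcSigned.Setting`**: for `W⁄K` in Castella–Wan's
setting (`a_p = 0`, `p = 𝔭𝔭′` split, `κ` anticyclotomic, `p ∤ h_K`), a topological generator `γ`, EVERY family
of local conditions `𝓛`, every `f ∈ Λ^ac` and every `x ∈ Sel^{𝓛}(K, 𝐓^ac)`: `f • x = 0 → f = 0 ∨ x = 0`
(structure `selmerLambdaAdic.moduleOfGen`). Castella–Wan (proof of Thm. 6.8, MS p. 30): "`E(K)[p] = 0` …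
`E(K_∞)[p^∞] = 0`, which by [PR00, §1.3.3] implies that the `Λ^ac`-torsion submodule of `H¹(K, 𝐓^ac)` is
trivial". Kernel proof: `E(K)[p] = 0` in the `Setting` (`noPTorsion_base_of_setting`) and the levelwise
torsion-freeness `selmerLambdaAdic.forall_smul_eq_zero_imp`. The statement is the type of the field VERBATIM
for the consumers' curve `W.baseChange K`; only this field is proved (the named fact
`castellaWan2024_proofThm68_transferInputs` keeps its other five fields as literature inputs).
[cite: CastellaWan2023, proof of Thm. 6.8 (MS p. 30)] [cite: PerrinRiou1995Asterisque, §1.3.3]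
[cite: IovitaPollack2006, Lemma 2.1 (arXiv:math/0411496 p. 5)] -/
theorem transferInputs_torsionFree_of_setting (hS : Setting W K p κ 𝔭 𝔭') (γ : absoluteGaloisGroup K)
    (hγ : κ.IsTopGenerator γ) :
    ∀ (𝓛 : HeightOneSpectrum (𝓞 K) → PCond) (f : IwasawaAlgebra p)
      (x : selmerLambdaAdic (W.baseChange K) p κ γ 𝓛),
      (letI := selmerLambdaAdic.moduleOfGen (W.baseChange K) p κ γ hγ 𝓛; f • x) = 0 → f = 0 ∨ x = 0 := by
  haveI : W.IsElliptic := hS.isElliptic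
  haveI : (W.baseChange K).IsElliptic := by rw [WeierstrassCurve.baseChange]; infer_instance
  exact selmerLambdaAdic.forall_smul_eq_zero_imp hγ (noPTorsion_base_of_setting W K p κ 𝔭 𝔭' hS)

/-- **A non-zero class of `Sel^{𝓛}(K, 𝐓^ac)` is non-torsion in the `Setting`**: `x ≠ 0 ⇒ f • x ≠ 0` for every
`f ≠ 0` — the form in which torsion-freeness is consumed (e.g. for the signed Heegner class `z^±_∞`, once it is
known to be non-zero, every non-zero multiple survives; cf. `TransferInputs.smul_eq_zero_imp`).
[cite: CastellaWan2023, proof of Thm. 6.8 (MS p. 30)] [cite: PerrinRiou1995Asterisque, §1.3.3] -/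
theorem smul_ne_zero_of_setting (hS : Setting W K p κ 𝔭 𝔭') (γ : absoluteGaloisGroup K)
    (hγ : κ.IsTopGenerator γ) (𝓛 : HeightOneSpectrum (𝓞 K) → PCond) {f : IwasawaAlgebra p} (hf : f ≠ 0)
    {x : selmerLambdaAdic (W.baseChange K) p κ γ 𝓛} (hx : x ≠ 0) :
    (letI := selmerLambdaAdic.moduleOfGen (W.baseChange K) p κ γ hγ 𝓛; f • x) ≠ 0 :=
  fun h ↦ ((transferInputs_torsionFree_of_setting W K p κ 𝔭 𝔭' hS γ hγ 𝓛 f x h).resolve_left hf |> hx)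

end Summit.BirchSwinnertonDyer.BirchSwinnertonDyer.Theorems.SignedBaseChangeAcDivTransferTorsionFree

end
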